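import Summits.QuantumFields.YangMills.Theorems.LuscherReductionTwistedTraceScalingBTKineticSquares
import Summits.QuantumFields.YangMills.Theorems.LuscherReductionTwistedTraceScalingBTWindow
import HarnessLib

/-!
# (C5-α, S1/S2/S9) QUATERNION BOOKKEEPING FOR STIFF SEPARATION: jumps from the kinetic defect, reduction to a based gauge field by colour conjugation, per-link extraction
# (lane A of S-BASE, crux `TwistedTraceScaling` stmt-QuantumFields-20203, C4-CORE, the (OD) pen; sub-lemmas S1, S2, S9 of `pub/ym-fleet/ym-luscher-20007-p1/Lines-stiff-separation.md`)

Three elementary steps of the stiff-separation estimate (the last analytic input of the hOD brick, COARSE-DESIGN §30.6 (d)), all exact unit-quaternion algebra: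
* §1 (S1) `norm_jump_le_of_edgeDefect` — `‖q(g_y) − q(g_x)‖ ≤ ‖Δ_e‖ + ‖q(U_e) − 1‖ + ‖q(V_e) − 1‖` (`Δ_e = q(U_e)q(g_y) − q(g_x)q(V_e)` the edge defect); ★ `jump_le_of_kinDefect_le` —
  `kinDefect U V g ≤ d²` and links of `U`, `V` within `a`, `b` of `1` force every jump of `g` below `d + a + b`; ★ `norm_based_sub_one_le_of_kinDefect_le` — hence the BASED field
  `η_x = g_0⁻¹g_x` satisfies `‖q(η_x) − 1‖ ≤ 3L(d + a + b)` (`…BTKineticSquares.norm_su2Quat_sub_base_le`);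
* §2 (S2) ★ `kinDefect_const_mul` — `kinDefect U V (c·η) = kinDefect (c⁻¹Uc) V η`: a constant colour factor moves onto the first argument (where, for tube points,
  `c⁻¹(oT u' x')c = oT (c⁻¹u'c) (Ad_{c⁻¹}x')` by `gaugeTransform_const_orthoTube`, all stiff-separation hypotheses being `Ad`-invariant);
* §3 (S9) `norm_sub_le_of_mul_right` — `‖q(A) − q(B)‖ ≤ ‖q(A)q(a) − q(B)q(b)‖ + ‖q(a) − q(b)‖`; `abs_vecPart_sub_le` — `|A⃗_c − B⃗_c| ≤ ‖q(A) − q(B)‖`: the vector parts of the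
  transverse factors of two kinetically close tube links differ by at most the edge defect plus the slow mismatch.
HONEST FRAMING: bookkeeping for a stub of a child of the CONDITIONAL route R2b1; (SEP) S6′/S8′ and the hOD assembly, (B-ST), C4-CORE OPEN; not infinite volume, not a gap, not Clay.
-/

set_option autoImplicit false

noncomputable section

open MeasureTheory Filter Topology Real
open scoped BigOperators Matrix Quaternion
open Literature.MathematicalPhysics.QuantumFieldTheory
open Literature.MathematicalPhysics.QuantumLattice

namespace Summit.QuantumFields.YangMills.Theorems.FemtoTransferGap.TwoLattice.ConstTube

open Summit.QuantumFields.YangMills.Theorems.FemtoTransferGap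
open Summit.QuantumFields.YangMills.Theorems.FemtoTransferGap.TwoLattice
open Summit.QuantumFields.YangMills.Theorems.FemtoTransferGap.TwoLattice.Avg

variable {L : ℕ} [NeZero L]

/-! ## §1 (S1) Jumps from the kinetic defect -/

omit [NeZero L] in
/-- `‖q(g_y) − q(g_x)‖ ≤ ‖q(U)q(g_y) − q(g_x)q(V)‖ + ‖q(U) − 1‖ + ‖q(V) − 1‖` (`q(g_y) − q(g_x) = Δ − (q(U) − 1)q(g_y) + q(g_x)(q(V) − 1)`, unit norms). [folklore] -/
theorem norm_jump_le_of_edgeDefect (U V gx gy : SU2) :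
    ‖su2Quat gy - su2Quat gx‖ ≤ ‖su2Quat U * su2Quat gy - su2Quat gx * su2Quat V‖ + ‖su2Quat U - 1‖ + ‖su2Quat V - 1‖ := by
  have e : su2Quat gy - su2Quat gx = (su2Quat U * su2Quat gy - su2Quat gx * su2Quat V) - (su2Quat U - 1) * su2Quat gy + su2Quat gx * (su2Quat V - 1) := by
    noncomm_ring
  have h1 : ‖(su2Quat U - 1) * su2Quat gy‖ = ‖su2Quat U - 1‖ := by rw [norm_mul, norm_su2Quat, mul_one]
  have h2 : ‖su2Quat gx * (su2Quat V - 1)‖ = ‖su2Quat V - 1‖ := by rw [norm_mul, norm_su2Quat, one_mul]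
  calc ‖su2Quat gy - su2Quat gx‖ = ‖(su2Quat U * su2Quat gy - su2Quat gx * su2Quat V) - (su2Quat U - 1) * su2Quat gy + su2Quat gx * (su2Quat V - 1)‖ := by rw [← e]
    _ ≤ ‖(su2Quat U * su2Quat gy - su2Quat gx * su2Quat V) - (su2Quat U - 1) * su2Quat gy‖ + ‖su2Quat gx * (su2Quat V - 1)‖ := norm_add_le _ _
    _ ≤ ‖su2Quat U * su2Quat gy - su2Quat gx * su2Quat V‖ + ‖(su2Quat U - 1) * su2Quat gy‖ + ‖su2Quat gx * (su2Quat V - 1)‖ := by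
        gcongr; exact norm_sub_le _ _
    _ = _ := by rw [h1, h2]

/-- ★ **SMALL KINETIC DEFECT ⇒ SMALL JUMPS**: `kinDefect U V g ≤ d²` (`d ≥ 0`), `‖q(U_e) − 1‖ ≤ a`, `‖q(V_e) − 1‖ ≤ b` for all `e` ⇒ every jump `‖q(g_{x+k}) − q(g_x)‖ ≤ d + a + b`.
[folklore] -/
theorem jump_le_of_kinDefect_le {U V : GaugeConfig 3 L SU2} {g : Site 3 L → SU2} {d a b : ℝ} (hd : 0 ≤ d) (hK : kinDefect L U V g ≤ d ^ 2)
    (ha : ∀ e, ‖su2Quat (U e) - 1‖ ≤ a) (hb : ∀ e, ‖su2Quat (V e) - 1‖ ≤ b) (e : Edge 3 L) :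
    ‖su2Quat (g (e.1.shift e.2)) - su2Quat (g e.1)‖ ≤ d + a + b := by
  have hΔ : ‖su2Quat (U e) * su2Quat (g (e.1.shift e.2)) - su2Quat (g e.1) * su2Quat (V e)‖ ≤ d := by
    have hsq := (sq_edgeDefect_le_kinDefect U V g e).trans hK
    exact (pow_le_pow_iff_left₀ (norm_nonneg _) hd two_ne_zero).mp hsq
  linarith [norm_jump_le_of_edgeDefect (U e) (V e) (g e.1) (g (e.1.shift e.2)), ha e, hb e]

/-- ★ **THE BASED FIELD IS NEAR `1`**: under the same hypotheses, `η_x = g_0⁻¹g_x` has `‖q(η_x) − 1‖ ≤ 3L(d + a + b)` for every `x`. [folklore] -/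
theorem norm_based_sub_one_le_of_kinDefect_le {U V : GaugeConfig 3 L SU2} {g : Site 3 L → SU2} {d a b : ℝ} (hd : 0 ≤ d) (hK : kinDefect L U V g ≤ d ^ 2)
    (ha : ∀ e, ‖su2Quat (U e) - 1‖ ≤ a) (hb : ∀ e, ‖su2Quat (V e) - 1‖ ≤ b) (x : Site 3 L) :
    ‖su2Quat ((g 0)⁻¹ * g x) - 1‖ ≤ 3 * L * (d + a + b) := by
  have hmul := @Literature.MathematicalPhysics.QuantumFieldTheory.Balaban1983to89.T4HaarSU2Translate.su2Quat_mul
  have hpath := norm_su2Quat_sub_base_le (L := L) (fun e => jump_le_of_kinDefect_le hd hK ha hb e) x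
  have e : su2Quat ((g 0)⁻¹ * g x) - 1 = su2Quat (g 0)⁻¹ * (su2Quat (g x) - su2Quat (g 0)) := by
    have h1 : su2Quat (g 0)⁻¹ * su2Quat (g 0) = 1 := by rw [← hmul, inv_mul_cancel, su2Quat_one]
    rw [hmul, mul_sub, h1]
  rw [e, norm_mul, norm_su2Quat, one_mul]
  exact hpath

/-! ## §2 (S2) A constant colour factor moves onto the first argument -/

/-- ★ **`kinDefect U V (c·η) = kinDefect (c⁻¹Uc) V η`** (`c⁻¹Uc = gaugeTransform (fun _ ↦ c⁻¹) U`). [folklore] -/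
theorem kinDefect_const_mul (U V : GaugeConfig 3 L SU2) (c : SU2) (η : Site 3 L → SU2) :
    kinDefect L U V (fun x => c * η x) = kinDefect L (gaugeTransform (fun _ : Site 3 L => c⁻¹) U) V η := by
  have hmul := @Literature.MathematicalPhysics.QuantumFieldTheory.Balaban1983to89.T4HaarSU2Translate.su2Quat_mul
  unfold kinDefect
  refine Finset.sum_congr rfl fun e _ => ?_
  have hge : gaugeTransform (fun _ : Site 3 L => c⁻¹) U e = c⁻¹ * U e * c⁻¹⁻¹ := rfl
  rw [hge, inv_inv]
  have h1 : su2Quat c * su2Quat c⁻¹ = 1 := by rw [← hmul, mul_inv_cancel, su2Quat_one]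
  have key : su2Quat c * su2Quat (c⁻¹ * U e * c) = su2Quat (U e) * su2Quat c := by rw [hmul, hmul, ← mul_assoc, ← mul_assoc, h1, one_mul]
  have e1 : su2Quat (U e) * su2Quat (c * η (e.1.shift e.2)) - su2Quat (c * η e.1) * su2Quat (V e) =
      su2Quat c * (su2Quat (c⁻¹ * U e * c) * su2Quat (η (e.1.shift e.2)) - su2Quat (η e.1) * su2Quat (V e)) := by
    rw [hmul, hmul, mul_sub, ← mul_assoc (su2Quat c), key]; noncomm_ring
  rw [e1, norm_mul, norm_su2Quat, one_mul]

/-! ## §3 (S9) Per-link extraction -/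

omit [NeZero L] in
/-- `‖q(A) − q(B)‖ ≤ ‖q(A)q(a) − q(B)q(b)‖ + ‖q(a) − q(b)‖` (unit norms). [folklore] -/
theorem norm_sub_le_of_mul_right (A B a b : SU2) :
    ‖su2Quat A - su2Quat B‖ ≤ ‖su2Quat A * su2Quat a - su2Quat B * su2Quat b‖ + ‖su2Quat a - su2Quat b‖ := by
  have e : (su2Quat A - su2Quat B) * su2Quat a = (su2Quat A * su2Quat a - su2Quat B * su2Quat b) - su2Quat B * (su2Quat a - su2Quat b) := by noncomm_ring
  have h0 : ‖su2Quat A - su2Quat B‖ = ‖(su2Quat A - su2Quat B) * su2Quat a‖ := by rw [norm_mul, norm_su2Quat, mul_one]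
  have h2 : ‖su2Quat B * (su2Quat a - su2Quat b)‖ = ‖su2Quat a - su2Quat b‖ := by rw [norm_mul, norm_su2Quat, one_mul]
  rw [h0, e]
  exact (norm_sub_le _ _).trans (by rw [h2])

omit [NeZero L] in
/-- `|A⃗_c − B⃗_c| ≤ ‖q(A) − q(B)‖`: the vector part is `1`-Lipschitz componentwise. [folklore] -/
theorem abs_vecPart_sub_le (A B : SU2) (c : Fin 3) : |vecPart A c - vecPart B c| ≤ ‖su2Quat A - su2Quat B‖ := by
  have h := Quaternion.normSq_def' (su2Quat A - su2Quat B)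
  have hn : ‖su2Quat A - su2Quat B‖ ^ 2 = (su2Quat A - su2Quat B).re ^ 2 + (su2Quat A - su2Quat B).imI ^ 2 + (su2Quat A - su2Quat B).imJ ^ 2 + (su2Quat A - su2Quat B).imK ^ 2 := by
    rw [← h, Quaternion.normSq_eq_norm_mul_self, sq]
  have hc : (vecPart A c - vecPart B c) ^ 2 ≤ ‖su2Quat A - su2Quat B‖ ^ 2 := by
    rw [hn]
    fin_cases c <;> simp [vecPart] <;> nlinarith [sq_nonneg (su2Quat A - su2Quat B).re, sq_nonneg (su2Quat A - su2Quat B).imI,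
      sq_nonneg (su2Quat A - su2Quat B).imJ, sq_nonneg (su2Quat A - su2Quat B).imK]
  exact abs_le_of_sq_le_sq' hc (norm_nonneg _) |> fun h => abs_le.mpr ⟨by linarith [h.1], h.2⟩

end Summit.QuantumFields.YangMills.Theorems.FemtoTransferGap.TwoLattice.ConstTube

end
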